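import Literature.NumberTheory.DiophantineGeometry.AbcHitCountUpperBoundProofs

/-!
# Crux `TwistAmplification.SharpModerateLaw` (stmt-ABC-1975), line `deep-moduli-cusp-dispersion`:
Rankin-type radical class counts

Two registered helper sub-goals of the dispersion stubs of the line (every class decomposition of
the two dispersion stubs sums a per-modulus bound over the admissible moduli
`{e powerful : rad e ≤ Q}`; these are the class count and the admissible-`Δ` multiplicity):

* `boundedRadicalCount_holds` — `#{e ≤ T : rad e ≤ Q} ≤ C_δ Q^{1+δ} T^δ`;
* `powerfulInvRadicalSum_holds` — `Σ_{e ≤ T, e powerful} 1/rad e ≤ C_δ T^δ`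
  (the powerful condition is not even needed: `Σ_{e ≤ T} 1/rad e ≤ C_δ T^δ`).

Here `rad e = ∏_{p ∣ e} p = UniqueFactorizationMonoid.radical e`
(`Nat.radical_eq_prod_primeFactors`).  Both are Rankin's method [folklore], in the form already in
the library: the radical fibres `{u ≤ X : rad u = r}` have `≤ K_η X^η r^η` elements
(`Literature.NumberTheory.DiophantineGeometry.AbcHits.card_radFibre_le`, from Rankin's bound
`#{k ≤ X : p ∣ k ⇒ p ∈ P} ≤ X^η ∏_{p ∈ P} (1 − p^{−η})⁻¹` and `∏_{p ∣ r} (1 − p^{−η})⁻¹ ≤ K_η r^η`).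
Fibring over the radical `r`:

* `#{e ≤ T : rad e ≤ Q} = Σ_{r ≤ Q} #{e ≤ T : rad e = r} ≤ Σ_{r ≤ Q} K T^δ Q^δ ≤ K Q^{1+δ} T^δ`;
* `Σ_{e ≤ T} 1/rad e = Σ_{r ≤ T} (1/r) #{e ≤ T : rad e = r} ≤ K T^{2η} Σ_{r ≤ T} 1/r
  ≤ K T^{2η} (1 + log T) ≤ K (1 + 1/η) T^{3η}` (`harmonic_le_one_add_log`, `log T ≤ T^η/η`),
  with `η = δ/3`.
-/

noncomputable section

namespace Summit.ABC.ABC.Theorems.SharpModerateLaw.CuspDispersion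

open UniqueFactorizationMonoid Finset

/-- **Integers with bounded radical are few** (Rankin's method [folklore]): for `δ > 0` there is
`C` with `#{e ≤ T : rad e ≤ Q} ≤ C · Q ^ (1 + δ) · T ^ δ` for all real `T, Q ≥ 1`, where
`rad e = ∏_{p ∣ e} p`.  Proof: fibre over `r = rad e ∈ [1, Q]`; each fibre `{e ≤ T : rad e = r}` has
`≤ K_δ T^δ r^δ ≤ K_δ T^δ Q^δ` elements (`AbcHits.card_radFibre_le`), and there are `≤ Q` fibres. -/
theorem boundedRadicalCount_holds : ∀ δ : ℝ, 0 < δ → ∃ C : ℝ, ∀ T Q : ℝ, 1 ≤ T → 1 ≤ Q → ((((Finset.Icc 1 ⌊T⌋₊).filter (fun e : ℕ => ((∏ p ∈ e.primeFactors, p : ℕ) : ℝ) ≤ Q)).card : ℕ) : ℝ) ≤ C * Q ^ (1 + δ) * T ^ δ := by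
  intro δ hδ
  obtain ⟨K, hK, hKb⟩ :=
    Literature.NumberTheory.DiophantineGeometry.AbcHits.card_radFibre_le hδ
  refine ⟨K, fun T Q hT hQ => ?_⟩
  have hT0 : (0 : ℝ) ≤ T := by linarith
  have hQ0 : (0 : ℝ) ≤ Q := by linarith
  have hQpos : (0 : ℝ) < Q := by linarith
  have hXT : ((⌊T⌋₊ : ℕ) : ℝ) ≤ T := Nat.floor_le hT0
  have hRQ : ((⌊Q⌋₊ : ℕ) : ℝ) ≤ Q := Nat.floor_le hQ0
  -- the radical maps the set into `[1, ⌊Q⌋₊]`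
  have hmaps : Set.MapsTo (fun e : ℕ => radical e)
      (((Finset.Icc 1 ⌊T⌋₊).filter
        (fun e : ℕ => ((∏ p ∈ e.primeFactors, p : ℕ) : ℝ) ≤ Q) : Finset ℕ) : Set ℕ)
      ((Finset.Icc 1 ⌊Q⌋₊ : Finset ℕ) : Set ℕ) := by
    intro e he
    rw [mem_coe, mem_filter] at he
    rw [mem_coe, mem_Icc]
    refine ⟨Nat.radical_pos e, ?_⟩
    rw [Nat.le_floor_iff hQ0]
    show ((radical e : ℕ) : ℝ) ≤ Q
    rw [Nat.radical_eq_prod_primeFactors]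
    exact he.2
  rw [card_eq_sum_card_fiberwise hmaps, Nat.cast_sum]
  -- each fibre is small
  have hfib : ∀ r ∈ Finset.Icc 1 ⌊Q⌋₊,
      ((((Finset.Icc 1 ⌊T⌋₊).filter
          (fun e : ℕ => ((∏ p ∈ e.primeFactors, p : ℕ) : ℝ) ≤ Q)).filter
          (fun e : ℕ => radical e = r)).card : ℝ) ≤
        K * T ^ δ * Q ^ δ := by
    intro r hr
    obtain ⟨hr1, hrR⟩ := mem_Icc.mp hr
    have hrQ : (r : ℝ) ≤ Q := le_trans (by exact_mod_cast hrR) hRQ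
    calc ((((Finset.Icc 1 ⌊T⌋₊).filter
            (fun e : ℕ => ((∏ p ∈ e.primeFactors, p : ℕ) : ℝ) ≤ Q)).filter
            (fun e : ℕ => radical e = r)).card : ℝ)
        ≤ #{u ∈ Icc 1 ⌊T⌋₊ | radical u = r} := by
          exact_mod_cast card_le_card (fun u hu => by
            simp only [mem_filter] at hu ⊢
            exact ⟨hu.1.1, hu.2⟩)
      _ ≤ K * ((⌊T⌋₊ : ℕ) : ℝ) ^ δ * (r : ℝ) ^ δ := hKb _ r hr1
      _ ≤ K * T ^ δ * Q ^ δ := by gcongr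
  calc ∑ r ∈ Finset.Icc 1 ⌊Q⌋₊, ((((Finset.Icc 1 ⌊T⌋₊).filter
          (fun e : ℕ => ((∏ p ∈ e.primeFactors, p : ℕ) : ℝ) ≤ Q)).filter
          (fun e : ℕ => radical e = r)).card : ℝ)
      ≤ ∑ r ∈ Finset.Icc 1 ⌊Q⌋₊, K * T ^ δ * Q ^ δ := sum_le_sum hfib
    _ = ((⌊Q⌋₊ : ℕ) : ℝ) * (K * T ^ δ * Q ^ δ) := by
        rw [sum_const, Nat.card_Icc, add_tsub_cancel_right, nsmul_eq_mul]
    _ ≤ Q * (K * T ^ δ * Q ^ δ) := by gcongr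
    _ = K * Q ^ (1 + δ) * T ^ δ := by
        rw [Real.rpow_add hQpos, Real.rpow_one]; ring

/-- **The reciprocal radical has small average** (Rankin's method [folklore]): for `δ > 0` there
is `C` with `Σ_{e ≤ T, e powerful} 1/rad e ≤ C · T ^ δ` for all real `T ≥ 1`, where
`rad e = ∏_{p ∣ e} p` and `e` powerful means `p ∣ e ⇒ p² ∣ e` (the restriction to powerful `e` is
not used).  Proof: fibre over `r = rad e ∈ [1, T]`; on the fibre the summand is `1/r` and the fibre
has `≤ K T^{δ/3} r^{δ/3} ≤ K T^{2δ/3}` elements (`AbcHits.card_radFibre_le`), while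
`Σ_{r ≤ T} 1/r ≤ 1 + log T ≤ (1 + 3/δ) T^{δ/3}`. -/
theorem powerfulInvRadicalSum_holds : ∀ δ : ℝ, 0 < δ → ∃ C : ℝ, ∀ T : ℝ, 1 ≤ T → (∑ e ∈ (Finset.Icc 1 ⌊T⌋₊).filter (fun e : ℕ => ∀ p ∈ e.primeFactors, p ^ 2 ∣ e), (1 : ℝ) / ((∏ p ∈ e.primeFactors, p : ℕ) : ℝ)) ≤ C * T ^ δ := by
  intro δ hδ
  have hη : 0 < δ / 3 := by positivity
  obtain ⟨K, hK, hKb⟩ :=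
    Literature.NumberTheory.DiophantineGeometry.AbcHits.card_radFibre_le hη
  refine ⟨K * (1 + 3 / δ), fun T hT => ?_⟩
  have hT0 : (0 : ℝ) ≤ T := by linarith
  have hXT : ((⌊T⌋₊ : ℕ) : ℝ) ≤ T := Nat.floor_le hT0
  have hX1 : 1 ≤ ⌊T⌋₊ := Nat.le_floor (by simpa using hT)
  have hX1' : (1 : ℝ) ≤ ((⌊T⌋₊ : ℕ) : ℝ) := by exact_mod_cast hX1
  have hXpos : (0 : ℝ) < ((⌊T⌋₊ : ℕ) : ℝ) := by linarith
  -- the radical maps the range into `[1, ⌊T⌋₊]`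
  have hmaps : ∀ e ∈ (Finset.Icc 1 ⌊T⌋₊).filter (fun e : ℕ => ∀ p ∈ e.primeFactors, p ^ 2 ∣ e),
      radical e ∈ Finset.Icc 1 ⌊T⌋₊ := by
    intro e he
    rw [mem_filter, mem_Icc] at he
    rw [mem_Icc]
    exact ⟨Nat.radical_pos e, (Nat.radical_le_self_iff.mpr (by omega)).trans he.1.2⟩
  rw [← sum_fiberwise_of_maps_to hmaps
    (fun e : ℕ => (1 : ℝ) / ((∏ p ∈ e.primeFactors, p : ℕ) : ℝ))]
  -- on the fibre of `r` the summand is `1/r` and the fibre is small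
  have hfib : ∀ r ∈ Finset.Icc 1 ⌊T⌋₊,
      (∑ e ∈ ((Finset.Icc 1 ⌊T⌋₊).filter
          (fun e : ℕ => ∀ p ∈ e.primeFactors, p ^ 2 ∣ e)).filter (fun e : ℕ => radical e = r),
        (1 : ℝ) / ((∏ p ∈ e.primeFactors, p : ℕ) : ℝ)) ≤
        (r : ℝ)⁻¹ * (K * ((⌊T⌋₊ : ℕ) : ℝ) ^ (δ / 3) * ((⌊T⌋₊ : ℕ) : ℝ) ^ (δ / 3)) := by
    intro r hr
    obtain ⟨hr1, hrX⟩ := mem_Icc.mp hr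
    rw [sum_congr rfl (g := fun _ : ℕ => (r : ℝ)⁻¹) (fun e he => by
      rw [mem_filter] at he
      rw [← Nat.radical_eq_prod_primeFactors, he.2, one_div])]
    rw [sum_const, nsmul_eq_mul, mul_comm]
    gcongr
    calc ((((Finset.Icc 1 ⌊T⌋₊).filter
            (fun e : ℕ => ∀ p ∈ e.primeFactors, p ^ 2 ∣ e)).filter
            (fun e : ℕ => radical e = r)).card : ℝ)
        ≤ #{u ∈ Icc 1 ⌊T⌋₊ | radical u = r} := by
          exact_mod_cast card_le_card (fun u hu => by
            simp only [mem_filter] at hu ⊢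
            exact ⟨hu.1.1, hu.2⟩)
      _ ≤ K * ((⌊T⌋₊ : ℕ) : ℝ) ^ (δ / 3) * (r : ℝ) ^ (δ / 3) := hKb _ r hr1
      _ ≤ K * ((⌊T⌋₊ : ℕ) : ℝ) ^ (δ / 3) * ((⌊T⌋₊ : ℕ) : ℝ) ^ (δ / 3) := by
          have hrX' : (r : ℝ) ≤ ((⌊T⌋₊ : ℕ) : ℝ) := by exact_mod_cast hrX
          gcongr
  -- the harmonic sum and the logarithm
  have hharm : ∑ s ∈ Finset.Icc 1 ⌊T⌋₊, (s : ℝ)⁻¹ ≤ 1 + Real.log ((⌊T⌋₊ : ℕ) : ℝ) := by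
    calc ∑ s ∈ Finset.Icc 1 ⌊T⌋₊, (s : ℝ)⁻¹ = (harmonic ⌊T⌋₊ : ℝ) := by
          rw [harmonic_eq_sum_Icc]; push_cast; rfl
      _ ≤ 1 + Real.log ((⌊T⌋₊ : ℕ) : ℝ) := harmonic_le_one_add_log _
  have hlog : 1 + Real.log ((⌊T⌋₊ : ℕ) : ℝ) ≤ (1 + 3 / δ) * ((⌊T⌋₊ : ℕ) : ℝ) ^ (δ / 3) := by
    have h1 : (1 : ℝ) ≤ ((⌊T⌋₊ : ℕ) : ℝ) ^ (δ / 3) := Real.one_le_rpow hX1' hη.le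
    have h2 : Real.log ((⌊T⌋₊ : ℕ) : ℝ) ≤ ((⌊T⌋₊ : ℕ) : ℝ) ^ (δ / 3) / (δ / 3) :=
      Real.log_le_rpow_div hXpos.le hη
    have h3 : ((⌊T⌋₊ : ℕ) : ℝ) ^ (δ / 3) / (δ / 3) = 3 / δ * ((⌊T⌋₊ : ℕ) : ℝ) ^ (δ / 3) := by
      field_simp
    rw [h3] at h2
    nlinarith
  have hpow : ((⌊T⌋₊ : ℕ) : ℝ) ^ (δ / 3) * ((⌊T⌋₊ : ℕ) : ℝ) ^ (δ / 3) *
      ((⌊T⌋₊ : ℕ) : ℝ) ^ (δ / 3) = ((⌊T⌋₊ : ℕ) : ℝ) ^ δ := by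
    rw [← Real.rpow_add hXpos, ← Real.rpow_add hXpos]
    congr 1
    ring
  calc ∑ r ∈ Finset.Icc 1 ⌊T⌋₊, (∑ e ∈ ((Finset.Icc 1 ⌊T⌋₊).filter
          (fun e : ℕ => ∀ p ∈ e.primeFactors, p ^ 2 ∣ e)).filter (fun e : ℕ => radical e = r),
          (1 : ℝ) / ((∏ p ∈ e.primeFactors, p : ℕ) : ℝ))
      ≤ ∑ r ∈ Finset.Icc 1 ⌊T⌋₊,
          (r : ℝ)⁻¹ * (K * ((⌊T⌋₊ : ℕ) : ℝ) ^ (δ / 3) * ((⌊T⌋₊ : ℕ) : ℝ) ^ (δ / 3)) :=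
        sum_le_sum hfib
    _ = (∑ r ∈ Finset.Icc 1 ⌊T⌋₊, (r : ℝ)⁻¹) *
          (K * ((⌊T⌋₊ : ℕ) : ℝ) ^ (δ / 3) * ((⌊T⌋₊ : ℕ) : ℝ) ^ (δ / 3)) := by
        rw [sum_mul]
    _ ≤ (1 + Real.log ((⌊T⌋₊ : ℕ) : ℝ)) *
          (K * ((⌊T⌋₊ : ℕ) : ℝ) ^ (δ / 3) * ((⌊T⌋₊ : ℕ) : ℝ) ^ (δ / 3)) := by
        gcongr
    _ ≤ ((1 + 3 / δ) * ((⌊T⌋₊ : ℕ) : ℝ) ^ (δ / 3)) *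
          (K * ((⌊T⌋₊ : ℕ) : ℝ) ^ (δ / 3) * ((⌊T⌋₊ : ℕ) : ℝ) ^ (δ / 3)) := by
        gcongr
    _ = K * (1 + 3 / δ) * (((⌊T⌋₊ : ℕ) : ℝ) ^ (δ / 3) * ((⌊T⌋₊ : ℕ) : ℝ) ^ (δ / 3) *
          ((⌊T⌋₊ : ℕ) : ℝ) ^ (δ / 3)) := by ring
    _ = K * (1 + 3 / δ) * ((⌊T⌋₊ : ℕ) : ℝ) ^ δ := by rw [hpow]
    _ ≤ K * (1 + 3 / δ) * T ^ δ := by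
        have : 0 ≤ K * (1 + 3 / δ) := by positivity
        gcongr

end Summit.ABC.ABC.Theorems.SharpModerateLaw.CuspDispersion

end
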